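import Summits.RiemannHypothesis.RiemannHypothesis.Theorems.PfPersistenceConeSigns
import Summits.RiemannHypothesis.RiemannHypothesis.Theorems.PfPersistenceTallyW2
import Summits.RiemannHypothesis.RiemannHypothesis.Theorems.PfPersistenceWeilParityPair
import Summits.RiemannHypothesis.RiemannHypothesis.Theorems.PfPersistenceDialMatching
import Summits.RiemannHypothesis.RiemannHypothesis.Theorems.PfPersistenceScaleInvariance
import HarnessLib

/-!
# PF persistence — the EIGENVECTOR-TOLERANCE classes (`L_k × R0`, `eigvec`/`theta` tiers) and their W2 wall
(pub-rhpf, barrier-prover gen 3; typer backlog G1.22ev / RULING A54 / C5-N5, lead g10 14:58Z)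

**HONEST FRAMING. This is a long-odds MECHANISM SEARCH; no RH claims.** Everything here is RH-free: finite-
dimensional linear algebra plus the cell's UNCONDITIONAL tally dichotomy
`tally_not_riemannHypothesis_or_negativesAccumulateNe` ((¬RH ∧ ζ detectably negative) ∨ detectably negative
ARITHMETIC data accumulate at `ζ` in `τ_unif`). Labels: every statement is PROVED; the only inputs that are not
theorems are the explicit, per-window NUMERICAL BINDERS `HasBottomGap (zetaDatum win) u₀ γ` (a certified bottom
vector of ONE real symmetric matrix with a variational gap) and `OneSignedMargin (2a) m₀ u₀` (its profile has margin
`m₀` on the window) — hypotheses of the theorems, never asserted.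

* §1 RELATIVE ROBUSTNESS `RobustWithin D₀ S d₀` (uniform robustness at `d₀` tested only against data in `D₀`) and
  the RELATIVE W2 WALL `not_separates_of_robustWithin_arith`: a class robust at `ζ` WITHIN THE ARITHMETIC DIAL
  SPACE separates `ζ` from the negatives of no `D ⊇ arithDialSpace` — unconditionally. (Eigenvector readers are
  not continuous on all of `Datum` — non-symmetric data need not have bottom vectors — so the absolute
  `UniformlyRobustAt` of `PfPersistenceTallyW2.two_walls` is the wrong tool for them; relative robustness within
  the (symmetric) dial space is the right one.) `RobustWithin.inter` makes JOINT classes (eigenvalue margins ∩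
  eigenvector tolerances) fall to the same wall.
* §2 THE EIGENVECTOR-TOLERANCE CLASS `evToleranceClass W U₀ τ` at finitely many windows `W i` with reference
  vectors `U₀ i`: data each of whose window matrices HAS a bottom vector and ALL of whose bottom vectors lie in the
  `τ`-cone `SinSqLe τ · (U₀ i)`. MAIN LEMMA `robustWithin_dialSpace_evToleranceClass`: under gap binders at `ζ` it
  is robust at `ζ` within `dialSpace` (variational Davis–Kahan, `PfPersistenceBottomVectors`), hence THE WALL
  `not_separates_of_evToleranceClass_subset` and its joint version with any reader-continuous margin class.
* §3 THE CONE LEMMA for bottom-vector SHAPE readers `{d | ∃ u, IsBottomVector (d win) u ∧ P u}` (and the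
  `∀ u` form): under a gap binder at `ζ`, if the shape `P` holds on a punctured `τ`-cone of `u₀`, the reader class
  is robust at `ζ` within `dialSpace` (`robustWithin_dialSpace_bottomVectorReaderAt`) and falls to the wall.
  THE ONE-SIGNED INSTANCE: with a profile-margin binder as well, `oneSignedAt win` (`T1_fin`: "some bottom vector
  has a one-signed profile") is robust at `ζ` within `dialSpace` (`robustWithin_dialSpace_oneSignedAt`), so
  (`oneSignedAt_shared_by_near_negatives`) either ¬RH with `ζ` itself detectably negative, or detectably negative
  ARITHMETIC data that are ALSO one-signed at `win` accumulate at `ζ`: nodelessness at a gapped window is shared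
  by the nearby negatives and cannot separate.
HONEST RESIDUE (recorded, not targeted): readers quantifying over ALL windows (sliding `a → ∞`, where the gap
`γ(win) → 0`) get no uniform `ε` from this file; they remain in gap class G1.
-/

set_option linter.dupNamespace false  -- the mandated namespace repeats `RiemannHypothesis`

noncomputable section

open Real Finset Matrix Set

namespace Summit.RiemannHypothesis.RiemannHypothesis.Theorems.PfPersistence

/-! ## §1 Relative robustness and the relative W2 wall -/

/-- `S` is UNIFORMLY ROBUST AT `d₀` WITHIN `D₀`: some `τ_unif`-ball around `d₀`, intersected with `D₀`, lies in
`S`. (`UniformlyRobustAt S d₀` is the case `D₀ = univ`.) -/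
def RobustWithin (D₀ S : Set Datum) (d₀ : Datum) : Prop :=
  ∃ ε : ℝ, 0 < ε ∧ ∀ d ∈ D₀, UniformlyClose ε d₀ d → d ∈ S

/-- PROVED: absolute robustness is relative robustness within every `D₀`. [folklore] -/
theorem UniformlyRobustAt.robustWithin {S : Set Datum} {d₀ : Datum} (h : UniformlyRobustAt S d₀)
    (D₀ : Set Datum) : RobustWithin D₀ S d₀ := by
  obtain ⟨ε, hε, hS⟩ := h
  exact ⟨ε, hε, fun d _ hd => hS d hd⟩

/-- PROVED: shrinking the test domain preserves relative robustness. [folklore] -/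
theorem RobustWithin.anti {D₀ D₁ S : Set Datum} {d₀ : Datum} (h : RobustWithin D₀ S d₀) (hD : D₁ ⊆ D₀) :
    RobustWithin D₁ S d₀ := by
  obtain ⟨ε, hε, hS⟩ := h
  exact ⟨ε, hε, fun d hd hc => hS d (hD hd) hc⟩

/-- PROVED: enlarging the class (it suffices on the test domain) preserves relative robustness. [folklore] -/
theorem RobustWithin.mono {D₀ S S' : Set Datum} {d₀ : Datum} (h : RobustWithin D₀ S d₀) (hS : S ∩ D₀ ⊆ S') :
    RobustWithin D₀ S' d₀ := by
  obtain ⟨ε, hε, h⟩ := h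
  exact ⟨ε, hε, fun d hd hc => hS ⟨h d hd hc, hd⟩⟩

/-- PROVED: JOINT CLASSES — the intersection of two relatively robust classes is relatively robust. [folklore] -/
theorem RobustWithin.inter {D₀ S₁ S₂ : Set Datum} {d₀ : Datum} (h₁ : RobustWithin D₀ S₁ d₀)
    (h₂ : RobustWithin D₀ S₂ d₀) : RobustWithin D₀ (S₁ ∩ S₂) d₀ := by
  obtain ⟨ε₁, hε₁, hS₁⟩ := h₁
  obtain ⟨ε₂, hε₂, hS₂⟩ := h₂
  exact ⟨min ε₁ ε₂, lt_min hε₁ hε₂, fun d hd hc =>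
    ⟨hS₁ d hd (hc.of_le (min_le_left _ _)), hS₂ d hd (hc.of_le (min_le_right _ _))⟩⟩

/-- **PROVED — THE RELATIVE W2 WALL, UNCONDITIONAL (RH-free).** A class uniformly robust at `ζ` WITHIN THE
ARITHMETIC DIAL SPACE separates `ζ` from the detectably negative data of no domain `D ⊇ arithDialSpace`: by the
tally dichotomy either `ζ` itself is detectably negative (and `ζ ∈ S ∩ D`), or detectably negative arithmetic data
come `τ_unif`-arbitrarily close to `ζ` and enter `S`. [folklore] -/
theorem not_separates_of_robustWithin_arith {S D : Set Datum} (hD : arithDialSpace ⊆ D)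
    (hS : RobustWithin arithDialSpace S zetaDatum) : ¬ Separates S D zetaDatum := by
  rintro ⟨hζ, hsep⟩
  obtain ⟨ε, hε, hrob⟩ := hS
  rcases tally_not_riemannHypothesis_or_negativesAccumulateNe with ⟨-, hneg⟩ | hacc
  · exact hsep zetaDatum (hD zetaDatum_mem_arithDialSpace) hneg hζ
  · obtain ⟨d, hd, -, hneg, hclose⟩ := hacc ε hε
    exact hsep d (hD hd) hneg (hrob d hd hclose)

/-- PROVED: the same wall for classes robust within the full dial space (or any `D₀ ⊇ arithDialSpace`). [folklore] -/
theorem not_separates_of_robustWithin {D₀ S D : Set Datum} (hD₀ : arithDialSpace ⊆ D₀) (hD : arithDialSpace ⊆ D)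
    (hS : RobustWithin D₀ S zetaDatum) : ¬ Separates S D zetaDatum :=
  not_separates_of_robustWithin_arith hD (hS.anti hD₀)

/-! ## §2 The eigenvector-tolerance class and its wall -/

/-- PROVED: dial-space data are symmetric at every window (`evenBlock_isSymm`). [folklore] -/
theorem isSymm_of_mem_dialSpace {d : Datum} (hd : d ∈ dialSpace) (win : Window) : (d win).IsSymm := by
  obtain ⟨w, rfl⟩ := hd
  exact evenBlock_isSymm w win

/-- PROVED: `ζ`'s window matrices are symmetric. [folklore] -/
theorem zetaDatum_isSymm (win : Window) : (zetaDatum win).IsSymm :=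
  isSymm_of_mem_dialSpace (arithDialSpace_subset_dialSpace zetaDatum_mem_arithDialSpace) win

/-- PROVED: every dial-space datum has a bottom vector at every window. [folklore] -/
theorem exists_isBottomVector_of_mem_dialSpace {d : Datum} (hd : d ∈ dialSpace) (win : Window) :
    ∃ u : Fin (win.N + 1) → ℝ, IsBottomVector (d win) u ∧ u ⬝ᵥ u = 1 :=
  exists_isBottomVector_of_isSymm (isSymm_of_mem_dialSpace hd win)

/-- THE EIGENVECTOR-TOLERANCE CLASS (`L_k × R0`, `eigvec` tier) at the windows `W i` with reference vectors `U₀ i`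
and tolerance `τ`: data each of whose window matrices `d (W i)` HAS a bottom vector, ALL of whose bottom vectors lie
in the `τ`-cone of `U₀ i` (`SinSqLe τ u (U₀ i)`, i.e. `sin² ∠(u, ±U₀ i) ≤ τ`). -/
def evToleranceClass {k : ℕ} (W : Fin k → Window) (U₀ : (i : Fin k) → (Fin ((W i).N + 1) → ℝ)) (τ : ℝ) :
    Set Datum :=
  {d | ∀ i, (∃ u, IsBottomVector (d (W i)) u) ∧ ∀ u, IsBottomVector (d (W i)) u → SinSqLe τ u (U₀ i)}

/-- PROVED (the A115 'scale-free' word): the eigenvector-tolerance class is SCALE-INVARIANT — `c • d` (`c > 0`)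
has the same bottom vectors as `d` at every window (`isBottomVector_smul_iff`), and the cone condition does not see
the datum's scale. [folklore] -/
theorem scaleInvariant_evToleranceClass {k : ℕ} (W : Fin k → Window) (U₀ : (i : Fin k) → (Fin ((W i).N + 1) → ℝ))
    (τ : ℝ) : ScaleInvariant (evToleranceClass W U₀ τ) := by
  intro c hc d
  simp only [evToleranceClass, mem_setOf_eq, smul_datum_apply, isBottomVector_smul_iff hc]

/-- PROVED (membership by Davis–Kahan): a datum SYMMETRIC at the windows and `ε`-close to a reference `d₀` that is
symmetric with gap binders `HasBottomGap (d₀ (W i)) (U₀ i) (γ i)` lies in the tolerance class as soon as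
`2ε/γ i ≤ τ` for every `i`. [folklore] -/
theorem mem_evToleranceClass_of_uniformlyClose {k : ℕ} {W : Fin k → Window}
    {U₀ : (i : Fin k) → (Fin ((W i).N + 1) → ℝ)} {γ : Fin k → ℝ} {d₀ d : Datum}
    (h₀ : ∀ i, (d₀ (W i)).IsSymm) (hgap : ∀ i, HasBottomGap (d₀ (W i)) (U₀ i) (γ i))
    (hd : ∀ i, (d (W i)).IsSymm) {ε τ : ℝ} (hclose : UniformlyClose ε d₀ d) (hτ : ∀ i, 2 * ε / γ i ≤ τ) :
    d ∈ evToleranceClass W U₀ τ := fun i =>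
  ⟨(exists_isBottomVector_of_isSymm (hd i)).imp fun _ h => h.1,
    fun _ hu => (sinSqLe_of_isBottomVector (h₀ i) (hgap i) (fun v => hclose (W i) v) hu).mono (hτ i)⟩

/-- PROVED (a uniform tolerance budget): for finitely many positive gaps there is one `ε > 0` with `2ε/γ i ≤ τ`
for all `i`. [folklore] -/
theorem exists_eps_forall_le {k : ℕ} {γ : Fin k → ℝ} (hγ : ∀ i, 0 < γ i) {τ : ℝ} (hτ : 0 < τ) :
    ∃ ε : ℝ, 0 < ε ∧ ∀ i, 2 * ε / γ i ≤ τ := by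
  set A : ℝ := 1 + ∑ j, (γ j)⁻¹ with hA_def
  have hsum : 0 ≤ ∑ j, (γ j)⁻¹ := Finset.sum_nonneg fun j _ => (inv_pos.mpr (hγ j)).le
  have hA : 0 < A := by linarith
  refine ⟨τ / (2 * A), div_pos hτ (by linarith), fun i => ?_⟩
  have hγi := hγ i
  have hAi : (γ i)⁻¹ ≤ A := by
    have := Finset.single_le_sum (fun j (_ : j ∈ Finset.univ) => (inv_pos.mpr (hγ j)).le) (Finset.mem_univ i)
    linarith
  have h1 : 1 ≤ A * γ i := by
    have := mul_le_mul_of_nonneg_right hAi hγi.le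
    rwa [inv_mul_cancel₀ hγi.ne'] at this
  have heq : 2 * (τ / (2 * A)) / γ i = τ / (A * γ i) := by
    field_simp
  rw [heq, div_le_iff₀ (mul_pos hA hγi)]
  exact le_mul_of_one_le_right hτ.le h1

/-- **PROVED — THE MAIN LEMMA: the eigenvector-tolerance class is robust at `ζ` WITHIN THE DIAL SPACE, modulo the
gap binders.** If `ζ`'s window matrices have certified bottom vectors `U₀ i` with variational gaps `γ i`
(`HasBottomGap`), then for every `τ > 0` some `τ_unif`-ball around `ζ`, intersected with `dialSpace`, lies in
`evToleranceClass W U₀ τ` (`ε := τ/(2(1 + Σ 1/γ i))`; existence of bottom vectors from symmetry, tolerance from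
the variational Davis–Kahan lemma). [folklore] -/
theorem robustWithin_dialSpace_evToleranceClass {k : ℕ} {W : Fin k → Window}
    {U₀ : (i : Fin k) → (Fin ((W i).N + 1) → ℝ)} {γ : Fin k → ℝ}
    (hgap : ∀ i, HasBottomGap (zetaDatum (W i)) (U₀ i) (γ i)) {τ : ℝ} (hτ : 0 < τ) :
    RobustWithin dialSpace (evToleranceClass W U₀ τ) zetaDatum := by
  obtain ⟨ε, hε, hle⟩ := exists_eps_forall_le (fun i => (hgap i).2.1) hτ
  exact ⟨ε, hε, fun d hd hc => mem_evToleranceClass_of_uniformlyClose (fun i => zetaDatum_isSymm (W i)) hgap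
    (fun i => isSymm_of_mem_dialSpace hd (W i)) hc hle⟩

/-- **PROVED — THE WALL FOR EIGENVECTOR-TOLERANCE CLASSES (`L_k × R0`, typer backlog G1.22ev), modulo the gap
binders at `ζ`, otherwise UNCONDITIONAL.** A class containing the arithmetic part of an eigenvector-tolerance class
of positive tolerance separates `ζ` from the negatives of no `D ⊇ arithDialSpace`. [folklore] -/
theorem not_separates_of_evToleranceClass_subset {k : ℕ} {W : Fin k → Window}
    {U₀ : (i : Fin k) → (Fin ((W i).N + 1) → ℝ)} {γ : Fin k → ℝ}
    (hgap : ∀ i, HasBottomGap (zetaDatum (W i)) (U₀ i) (γ i)) {τ : ℝ} (hτ : 0 < τ) {S D : Set Datum}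
    (hS : evToleranceClass W U₀ τ ∩ arithDialSpace ⊆ S) (hD : arithDialSpace ⊆ D) : ¬ Separates S D zetaDatum :=
  not_separates_of_robustWithin_arith hD
    (((robustWithin_dialSpace_evToleranceClass hgap hτ).anti arithDialSpace_subset_dialSpace).mono hS)

/-- PROVED (JOINT SHAPE READERS OF THE BOTTOM VECTORS AT `k` WINDOWS — the `L_k × R0` transport / direction
reader shape, universal form): if a property `P` of a TUPLE of coefficient vectors holds whenever each entry is
nonzero and in the `τ`-cone of `U₀ i`, the tolerance class lies in `{d | every tuple of bottom vectors has P}`.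
[folklore] -/
theorem evToleranceClass_subset_forall_tuple {k : ℕ} {W : Fin k → Window}
    {U₀ : (i : Fin k) → (Fin ((W i).N + 1) → ℝ)} {τ : ℝ}
    {P : ((i : Fin k) → (Fin ((W i).N + 1) → ℝ)) → Prop}
    (hP : ∀ u : (i : Fin k) → (Fin ((W i).N + 1) → ℝ), (∀ i, u i ≠ 0) → (∀ i, SinSqLe τ (u i) (U₀ i)) → P u) :
    evToleranceClass W U₀ τ ⊆
      {d | ∀ u : (i : Fin k) → (Fin ((W i).N + 1) → ℝ), (∀ i, IsBottomVector (d (W i)) (u i)) → P u} :=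
  fun _ hd u hu => hP u (fun i => (hu i).1) fun i => (hd i).2 (u i) (hu i)

/-- PROVED (the same, existential form): the tolerance class lies in `{d | SOME tuple of bottom vectors has P}`.
[folklore] -/
theorem evToleranceClass_subset_exists_tuple {k : ℕ} {W : Fin k → Window}
    {U₀ : (i : Fin k) → (Fin ((W i).N + 1) → ℝ)} {τ : ℝ}
    {P : ((i : Fin k) → (Fin ((W i).N + 1) → ℝ)) → Prop}
    (hP : ∀ u : (i : Fin k) → (Fin ((W i).N + 1) → ℝ), (∀ i, u i ≠ 0) → (∀ i, SinSqLe τ (u i) (U₀ i)) → P u) :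
    evToleranceClass W U₀ τ ⊆
      {d | ∃ u : (i : Fin k) → (Fin ((W i).N + 1) → ℝ), (∀ i, IsBottomVector (d (W i)) (u i)) ∧ P u} := by
  intro d hd
  choose u hu using fun i => (hd i).1
  exact ⟨u, hu, hP u (fun i => (hu i).1) fun i => (hd i).2 (u i) (hu i)⟩

/-- **PROVED — THE WALL FOR JOINT SHAPE READERS OF THE BOTTOM VECTORS AT FINITELY MANY GAPPED WINDOWS
(`L_k × R0` transport / direction readers), modulo the gap binders at `ζ` and the cone hypothesis on the shape,
otherwise UNCONDITIONAL.** Universal form; the existential form is the same proof with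
`evToleranceClass_subset_exists_tuple`. [folklore] -/
theorem not_separates_of_forall_tuple_subset {k : ℕ} {W : Fin k → Window}
    {U₀ : (i : Fin k) → (Fin ((W i).N + 1) → ℝ)} {γ : Fin k → ℝ}
    (hgap : ∀ i, HasBottomGap (zetaDatum (W i)) (U₀ i) (γ i)) {τ : ℝ} (hτ : 0 < τ)
    {P : ((i : Fin k) → (Fin ((W i).N + 1) → ℝ)) → Prop}
    (hP : ∀ u : (i : Fin k) → (Fin ((W i).N + 1) → ℝ), (∀ i, u i ≠ 0) → (∀ i, SinSqLe τ (u i) (U₀ i)) → P u)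
    {S D : Set Datum}
    (hS : {d | ∀ u : (i : Fin k) → (Fin ((W i).N + 1) → ℝ), (∀ i, IsBottomVector (d (W i)) (u i)) → P u} ∩
      arithDialSpace ⊆ S) (hD : arithDialSpace ⊆ D) : ¬ Separates S D zetaDatum :=
  not_separates_of_evToleranceClass_subset hgap hτ
    (fun _ hd => hS ⟨evToleranceClass_subset_forall_tuple hP hd.1, hd.2⟩) hD

/-- **PROVED — the existential-form wall for joint shape readers.** [folklore] -/
theorem not_separates_of_exists_tuple_subset {k : ℕ} {W : Fin k → Window}
    {U₀ : (i : Fin k) → (Fin ((W i).N + 1) → ℝ)} {γ : Fin k → ℝ}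
    (hgap : ∀ i, HasBottomGap (zetaDatum (W i)) (U₀ i) (γ i)) {τ : ℝ} (hτ : 0 < τ)
    {P : ((i : Fin k) → (Fin ((W i).N + 1) → ℝ)) → Prop}
    (hP : ∀ u : (i : Fin k) → (Fin ((W i).N + 1) → ℝ), (∀ i, u i ≠ 0) → (∀ i, SinSqLe τ (u i) (U₀ i)) → P u)
    {S D : Set Datum}
    (hS : {d | ∃ u : (i : Fin k) → (Fin ((W i).N + 1) → ℝ), (∀ i, IsBottomVector (d (W i)) (u i)) ∧ P u} ∩
      arithDialSpace ⊆ S) (hD : arithDialSpace ⊆ D) : ¬ Separates S D zetaDatum :=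
  not_separates_of_evToleranceClass_subset hgap hτ
    (fun _ hd => hS ⟨evToleranceClass_subset_exists_tuple hP hd.1, hd.2⟩) hD

/-- PROVED: a margin class of a reader continuous at `ζ` is robust at `ζ` within every `D₀`. [folklore] -/
theorem robustWithin_marginClass {k : ℕ} {F : Datum → Fin k → ℝ} (hF : ReaderContinuousAt F zetaDatum) {η : ℝ}
    (hη : 0 < η) (D₀ : Set Datum) : RobustWithin D₀ (marginClass F η) zetaDatum :=
  (uniformlyRobustAt_of_marginClass_subset hF hη subset_rfl).robustWithin D₀

/-- **PROVED — THE JOINT WALL (eigenvalue margins ∩ eigenvector tolerances), modulo the gap binders.** A class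
containing the arithmetic data that are BOTH within `η` of `ζ`'s readings of a reader `F` continuous at `ζ` (e.g.
finitely many windowed `ε₁`, `readerContinuousAt_bottomRayleigh`) AND in an eigenvector-tolerance class of positive
tolerance cannot separate. [folklore] -/
theorem not_separates_of_margin_inter_evTolerance_subset {k k' : ℕ} {F : Datum → Fin k' → ℝ}
    (hF : ReaderContinuousAt F zetaDatum) {η : ℝ} (hη : 0 < η) {W : Fin k → Window}
    {U₀ : (i : Fin k) → (Fin ((W i).N + 1) → ℝ)} {γ : Fin k → ℝ}
    (hgap : ∀ i, HasBottomGap (zetaDatum (W i)) (U₀ i) (γ i)) {τ : ℝ} (hτ : 0 < τ) {S D : Set Datum}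
    (hS : marginClass F η ∩ evToleranceClass W U₀ τ ∩ arithDialSpace ⊆ S) (hD : arithDialSpace ⊆ D) :
    ¬ Separates S D zetaDatum :=
  not_separates_of_robustWithin_arith hD
    ((((robustWithin_marginClass hF hη dialSpace).inter (robustWithin_dialSpace_evToleranceClass hgap hτ)).anti
      arithDialSpace_subset_dialSpace).mono hS)

/-! ## §3 The cone lemma for shape readers; the one-signed instance -/

/-- PROVED: under the binders `ζ` is itself one-signed at the window (consistency of the instance). [folklore] -/
theorem zetaDatum_mem_oneSignedAt_of_margin (win : Window) {u₀ : Fin (win.N + 1) → ℝ} {γ m₀ : ℝ}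
    (hgap : HasBottomGap (zetaDatum win) u₀ γ) (hmar : OneSignedMargin (2 * win.a) m₀ u₀) (hm₀ : 0 < m₀) :
    zetaDatum ∈ oneSignedAt win :=
  ⟨u₀, hgap.1, hmar.imp (fun h x hx => hm₀.le.trans (h x hx)) (fun h x hx => (h x hx).trans (by linarith))⟩

/-- **PROVED — THE CONE LEMMA for bottom-vector SHAPE readers at a gapped window (existential form).** If `ζ`'s
window matrix has a certified bottom vector `u₀` with variational gap `γ`, and a shape property `P` of coefficient
vectors holds on the whole punctured `τ`-cone of `u₀` (`u ≠ 0`, `SinSqLe τ u u₀`) for some `τ > 0`, then the reader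
class `{d | ∃ u, IsBottomVector (d win) u ∧ P u}` is robust at `ζ` within the dial space (`ε := τγ/2`; Davis–Kahan).
Instances: one-signed profiles (below), floored nodelessness, strict alignment thresholds, … [folklore] -/
theorem robustWithin_dialSpace_bottomVectorReaderAt (win : Window) {u₀ : Fin (win.N + 1) → ℝ} {γ : ℝ}
    (hgap : HasBottomGap (zetaDatum win) u₀ γ) {P : (Fin (win.N + 1) → ℝ) → Prop} {τ : ℝ} (hτ : 0 < τ)
    (hP : ∀ u, u ≠ 0 → SinSqLe τ u u₀ → P u) :
    RobustWithin dialSpace {d | ∃ u, IsBottomVector (d win) u ∧ P u} zetaDatum := by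
  have hγ : 0 < γ := hgap.2.1
  refine ⟨τ * γ / 2, by positivity, fun d hd hc => ?_⟩
  obtain ⟨u, hu, -⟩ := exists_isBottomVector_of_mem_dialSpace hd win
  have h := sinSqLe_of_isBottomVector (zetaDatum_isSymm win) hgap (fun v => hc win v) hu
  have heq : 2 * (τ * γ / 2) / γ = τ := by field_simp
  exact ⟨u, hu, hP u hu.1 (by rwa [heq] at h)⟩

/-- **PROVED — THE CONE LEMMA, universal form:** under the same hypotheses the class
`{d | ∀ u, IsBottomVector (d win) u → P u}` ("EVERY bottom vector has shape `P`") is robust at `ζ` within the dial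
space. [folklore] -/
theorem robustWithin_dialSpace_forall_bottomVectorReaderAt (win : Window) {u₀ : Fin (win.N + 1) → ℝ} {γ : ℝ}
    (hgap : HasBottomGap (zetaDatum win) u₀ γ) {P : (Fin (win.N + 1) → ℝ) → Prop} {τ : ℝ} (hτ : 0 < τ)
    (hP : ∀ u, u ≠ 0 → SinSqLe τ u u₀ → P u) :
    RobustWithin dialSpace {d | ∀ u, IsBottomVector (d win) u → P u} zetaDatum := by
  have hγ : 0 < γ := hgap.2.1
  refine ⟨τ * γ / 2, by positivity, fun _ _ hc u hu => ?_⟩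
  have h := sinSqLe_of_isBottomVector (zetaDatum_isSymm win) hgap (fun v => hc win v) hu
  have heq : 2 * (τ * γ / 2) / γ = τ := by field_simp
  exact hP u hu.1 (by rwa [heq] at h)

/-- **PROVED — THE WALL FOR BOTTOM-VECTOR SHAPE READERS AT A GAPPED WINDOW, modulo the gap binder and the cone
hypothesis on the shape, otherwise UNCONDITIONAL.** [folklore] -/
theorem not_separates_of_bottomVectorReaderAt_subset (win : Window) {u₀ : Fin (win.N + 1) → ℝ} {γ : ℝ}
    (hgap : HasBottomGap (zetaDatum win) u₀ γ) {P : (Fin (win.N + 1) → ℝ) → Prop} {τ : ℝ} (hτ : 0 < τ)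
    (hP : ∀ u, u ≠ 0 → SinSqLe τ u u₀ → P u) {S D : Set Datum}
    (hS : {d | ∃ u, IsBottomVector (d win) u ∧ P u} ∩ arithDialSpace ⊆ S) (hD : arithDialSpace ⊆ D) :
    ¬ Separates S D zetaDatum :=
  not_separates_of_robustWithin_arith hD
    (((robustWithin_dialSpace_bottomVectorReaderAt win hgap hτ hP).anti arithDialSpace_subset_dialSpace).mono hS)

/-- PROVED (the cone parameter for one-signed profiles): given `|u₀|²`, a margin `m₀ > 0`, the window length
`L > 0` and the cutoff `N`, an explicit `τ > 0` with `τ|u₀|²(2N+1) < (1 − τ)m₀²L`. [folklore] -/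
theorem exists_tau_profile_cone {s m₀ L : ℝ} (hs : 0 ≤ s) (hm₀ : 0 < m₀) (hL : 0 < L) (N : ℕ) :
    ∃ τ : ℝ, 0 < τ ∧ τ * s * (2 * N + 1) < (1 - τ) * m₀ ^ 2 * L := by
  set K : ℝ := s * (2 * N + 1) + m₀ ^ 2 * L with hK_def
  have hmL : 0 < m₀ ^ 2 * L := mul_pos (pow_pos hm₀ 2) hL
  have hK : 0 < K := by
    have : 0 ≤ s * (2 * N + 1) := mul_nonneg hs (by positivity)
    linarith
  refine ⟨m₀ ^ 2 * L / (2 * K), div_pos hmL (by linarith), ?_⟩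
  set τ : ℝ := m₀ ^ 2 * L / (2 * K) with hτ_def
  have hτ : 0 < τ := div_pos hmL (by linarith)
  have hτK : τ * K * 2 = m₀ ^ 2 * L := by
    rw [hτ_def]; field_simp
  have h1 : τ * s * (2 * N + 1) + τ * (m₀ ^ 2 * L) = τ * K := by
    rw [hK_def]; ring
  nlinarith [mul_pos hτ hmL]

/-- **PROVED — `oneSignedAt win` IS ROBUST AT `ζ` WITHIN THE DIAL SPACE, modulo a gap binder and a profile-margin
binder at that window.** If `ζ`'s window matrix has a certified bottom vector `u₀` with variational gap `γ` whose
profile is one-signed with margin `m₀ > 0` on `[−a, a]`, then every dial-space datum `τ_unif`-close enough to `ζ`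
has a bottom vector at `win` with a ONE-SIGNED profile (indeed all its bottom vectors are such: apply
`robustWithin_dialSpace_forall_bottomVectorReaderAt` with the same cone hypothesis). [folklore] -/
theorem robustWithin_dialSpace_oneSignedAt (win : Window) {u₀ : Fin (win.N + 1) → ℝ} {γ m₀ : ℝ}
    (hgap : HasBottomGap (zetaDatum win) u₀ γ) (hmar : OneSignedMargin (2 * win.a) m₀ u₀) (hm₀ : 0 < m₀) :
    RobustWithin dialSpace (oneSignedAt win) zetaDatum := by
  have hL : 0 < 2 * win.a := by linarith [win.ha]
  obtain ⟨τ, hτ, hdom⟩ := exists_tau_profile_cone (dotProduct_self_nonneg_real u₀) hm₀ hL win.N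
  exact robustWithin_dialSpace_bottomVectorReaderAt win hgap (P := OneSigned (2 * win.a)) hτ
    fun u hu hcone => oneSigned_of_sinSqLe hL hmar hm₀ hcone hu hdom

/-- **PROVED — THE WALL FOR `T1_fin` NEAR `ζ`, modulo the two binders.** A class containing the arithmetic data
one-signed at a gapped, margined window separates `ζ` from the negatives of no `D ⊇ arithDialSpace`. [folklore] -/
theorem not_separates_of_oneSignedAt_subset (win : Window) {u₀ : Fin (win.N + 1) → ℝ} {γ m₀ : ℝ}
    (hgap : HasBottomGap (zetaDatum win) u₀ γ) (hmar : OneSignedMargin (2 * win.a) m₀ u₀) (hm₀ : 0 < m₀)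
    {S D : Set Datum} (hS : oneSignedAt win ∩ arithDialSpace ⊆ S) (hD : arithDialSpace ⊆ D) :
    ¬ Separates S D zetaDatum :=
  not_separates_of_robustWithin_arith hD
    (((robustWithin_dialSpace_oneSignedAt win hgap hmar hm₀).anti arithDialSpace_subset_dialSpace).mono hS)

/-- **PROVED — NODELESSNESS IS SHARED BY THE NEARBY NEGATIVES (the informative form), modulo the two binders,
otherwise UNCONDITIONAL (RH-free).** Either RH fails with `ζ` itself detectably negative, or for every `ε > 0` there
is an ARITHMETIC dial-space datum `d ≠ ζ`, `ε`-close to `ζ` in `τ_unif`, DETECTABLY NEGATIVE, and ONE-SIGNED at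
the window `win`. So at a gapped, margined window the reading "the bottom profile is one-signed" takes the same
value on `ζ` and on negatives arbitrarily close to it. [folklore] -/
theorem oneSignedAt_shared_by_near_negatives (win : Window) {u₀ : Fin (win.N + 1) → ℝ} {γ m₀ : ℝ}
    (hgap : HasBottomGap (zetaDatum win) u₀ γ) (hmar : OneSignedMargin (2 * win.a) m₀ u₀) (hm₀ : 0 < m₀) :
    (¬ RiemannHypothesis ∧ DetectablyNegative zetaDatum) ∨
      ∀ ε : ℝ, 0 < ε → ∃ d ∈ arithDialSpace, d ≠ zetaDatum ∧ DetectablyNegative d ∧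
        UniformlyClose ε zetaDatum d ∧ d ∈ oneSignedAt win := by
  refine tally_not_riemannHypothesis_or_negativesAccumulateNe.imp_right fun hacc ε hε => ?_
  obtain ⟨ε₀, hε₀, hrob⟩ := robustWithin_dialSpace_oneSignedAt win hgap hmar hm₀
  obtain ⟨d, hd, hne, hneg, hclose⟩ := hacc (min ε ε₀) (lt_min hε hε₀)
  exact ⟨d, hd, hne, hneg, hclose.of_le (min_le_left _ _),
    hrob d (arithDialSpace_subset_dialSpace hd) (hclose.of_le (min_le_right _ _))⟩

/-- **PROVED — the same sharing statement for any eigenvector-tolerance class**, modulo the gap binders: either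
¬RH with `ζ` detectably negative, or detectably negative arithmetic data inside `evToleranceClass W U₀ τ` come
arbitrarily close to `ζ`. [folklore] -/
theorem evToleranceClass_shared_by_near_negatives {k : ℕ} {W : Fin k → Window}
    {U₀ : (i : Fin k) → (Fin ((W i).N + 1) → ℝ)} {γ : Fin k → ℝ}
    (hgap : ∀ i, HasBottomGap (zetaDatum (W i)) (U₀ i) (γ i)) {τ : ℝ} (hτ : 0 < τ) :
    (¬ RiemannHypothesis ∧ DetectablyNegative zetaDatum) ∨
      ∀ ε : ℝ, 0 < ε → ∃ d ∈ arithDialSpace, d ≠ zetaDatum ∧ DetectablyNegative d ∧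
        UniformlyClose ε zetaDatum d ∧ d ∈ evToleranceClass W U₀ τ := by
  refine tally_not_riemannHypothesis_or_negativesAccumulateNe.imp_right fun hacc ε hε => ?_
  obtain ⟨ε₀, hε₀, hrob⟩ := robustWithin_dialSpace_evToleranceClass hgap hτ
  obtain ⟨d, hd, hne, hneg, hclose⟩ := hacc (min ε ε₀) (lt_min hε hε₀)
  exact ⟨d, hd, hne, hneg, hclose.of_le (min_le_left _ _),
    hrob d (arithDialSpace_subset_dialSpace hd) (hclose.of_le (min_le_right _ _))⟩

end Summit.RiemannHypothesis.RiemannHypothesis.Theorems.PfPersistence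

end
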